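import Literature.RingTheory.DiscreteValuationRing.UnramifiedAdjoin
import Literature.AlgebraicGeometry.Resolution.FiniteOverCompleteLocal
import Literature.RingTheory.KrullDimension.AffineDimension
import Literature.AlgebraicGeometry.Resolution.RegularLocalRingsQuotient
import HarnessLib

/-!
# Crux `Steer` (stmt-ResolutionOfSingularities-16345), chain W4.1 — `HatBaseChangeX` infrastructure, part 1:
# the FINITE ÉTALE-TYPE EXTENSION `S′ = S[T]/(m̃)` of a hat ring is again a hat ring

OURS (campaign `res-hironaka`, rung L ★L-G4, slot W4.1; seat res-L0-w41-stub-4 g7 on res-L0-w41-plan-1 RULING 196d «stub-4 NEXT OBJECT =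
`HatBaseChangeX` … constructible WITHOUT Hensel via `AdjoinRoot` of σ m̄_c + `AdjoinRoot.lift`»). Replaces the role of no printed item; NOT a statement
of the manuscript under review [claim: Hironaka2017, status: under-review]; AI-produced, weaker than expert review. Theses-free, definition-free, words-free
(the word-level assembly `hatBaseChangeX_holds` follows when `IsHatRing`/`IsArithStage`/`IsXChartHat` are tree words).

SETTING. `S` a local ring with a coefficient-field section `σ : κ →+* S` (`κ = ResidueField S`, `residue ∘ σ = id`), `m ∈ κ[T]` monic irreducible,
`m̃ := m.map σ ∈ S[T]`, `S′ := AdjoinRoot m̃ = S[T]/(m̃)`, `ι := AdjoinRoot.of m̃`.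
* `map_map_residue_eq` — `m̃.map (residue S) = m`; `monic_map_section`, `irreducible_map_map_residue`.
* `isLocalRing_adjoinRoot_section` / `maximalIdeal_adjoinRoot_section` — `S′` is local with `𝔪_{S′} = 𝔪_S·S′` (tree: Matsumura 29.1 step,
  `Literature.RingTheory.DiscreteValuationRing.isLocalRing_adjoinRoot_of_irreducible_map`).
* `ringKrullDim_adjoinRoot_section` — `dim S′ = dim S` (finite injective extension; tree `ringKrullDim_eq_of_isIntegral`).
* `isRegularLocalRing_adjoinRoot_section` — `S` regular ⇒ `S′` regular (`𝔪_{S′}` is generated by the image of a minimal generating set of `𝔪_S`).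
* `isAdicComplete_adjoinRoot_section` — `S` Noetherian and `𝔪`-adically complete ⇒ `S′` is `𝔪_{S′}`-adically complete (tree `isAdicComplete_map_of_finite`).
* `nonempty_residueField_ringEquiv_adjoinRoot` — the residue field of `S′` is `κ[T]/(m)`; `perfectField_residueField_adjoinRoot` — perfect when `κ` is.
* `exists_section_adjoinRoot` — a coefficient-field SECTION `σ′` of `S′` with `residue ∘ σ′ = id`, `σ′ (residue (ι σ a)) = ι σ a`, `σ′ (residue θ) = θ`
  (`κ[T]/(m) → S′`, `T ↦ θ`, through `ι ∘ σ`, precomposed with `S′/𝔪′ → κ[T]/(m)`; helpers `mk_map_sub_mk_mem`, `lift_mk_eq_mk_map`, `of_injective_of_monic`).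
So for a hat ring `S` (complete regular local, dim 4, perfect `κ`, char 2) and `m = minpoly κ c`, `S′` is again a hat ring with residue field `κ(c)`
— the ring of the β-slot `HatBaseChangeX`; the chart clauses (`φ′ := AdjoinRoot.lift φ (σ₁ c)`, `IsXChartHat`, `IsArithStage` transport) follow in part 2.

[cite: Matsumura1987, proof of Thm. 29.1, p. 223] [folklore]
bears_on: LADDER-RESOLUTION L ★L-G4 W4.1 (crux `Steer`, binder hK4ⁿᶜ, β-slot `HatBaseChangeX`).
-/

noncomputable section

-- `Summit.<S>.<S>.…` duplicates the summit name by design (single-problem summit).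
set_option linter.dupNamespace false

open IsLocalRing Polynomial
open Literature.RingTheory.DiscreteValuationRing
open Literature.AlgebraicGeometry.Resolution

namespace Summit.ResolutionOfSingularities.ResolutionOfSingularities.Theorems.SwitchingDichotomy.HatBaseChange

universe u

variable {S : Type u} [CommRing S] [IsLocalRing S] (σ : ResidueField S →+* S) (hσ : ∀ a, residue S (σ a) = a)
  (m : Polynomial (ResidueField S))

/-! ## §1 The lifted polynomial `m̃ = m.map σ` -/

include hσ in
/-- Reducing the `σ`-lift of `m` gives back `m`. -/
theorem map_map_residue_eq : (m.map σ).map (residue S) = m := by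
  rw [Polynomial.map_map]
  have : (residue S).comp σ = RingHom.id _ := RingHom.ext hσ
  rw [this, Polynomial.map_id]

/-- The lift of a monic polynomial is monic. -/
theorem monic_map_section (hm : m.Monic) : (m.map σ).Monic := hm.map σ

include hσ in
/-- The lift of an irreducible polynomial has irreducible reduction. -/
theorem irreducible_map_map_residue (hirr : Irreducible m) : Irreducible ((m.map σ).map (residue S)) := by
  rwa [map_map_residue_eq σ hσ m]

/-! ## §2 `S′ = S[T]/(m̃)` is local with maximal ideal `𝔪_S · S′` -/

include hσ in
/-- `S[T]/(m̃)` is a local ring. [cite: Matsumura1987, proof of Thm. 29.1, p. 223] -/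
theorem isLocalRing_adjoinRoot_section (hm : m.Monic) (hirr : Irreducible m) : IsLocalRing (AdjoinRoot (m.map σ)) :=
  isLocalRing_adjoinRoot_of_irreducible_map (m.map σ) (monic_map_section σ m hm) (irreducible_map_map_residue σ hσ m hirr)

include hσ in
/-- The maximal ideal of `S[T]/(m̃)` is the extension of `𝔪_S`. [cite: Matsumura1987, proof of Thm. 29.1, p. 223] -/
theorem maximalIdeal_adjoinRoot_section (hm : m.Monic) (hirr : Irreducible m) :
    haveI := isLocalRing_adjoinRoot_section σ hσ m hm hirr
    maximalIdeal (AdjoinRoot (m.map σ)) = (maximalIdeal S).map (AdjoinRoot.of (m.map σ)) :=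
  maximalIdeal_adjoinRoot_eq_map (m.map σ) (monic_map_section σ m hm) (irreducible_map_map_residue σ hσ m hirr)

include hσ in
/-- The structure map `ι : S → S′` is a local homomorphism. -/
theorem isLocalHom_of_section (hm : m.Monic) (hirr : Irreducible m) :
    haveI := isLocalRing_adjoinRoot_section σ hσ m hm hirr
    IsLocalHom (AdjoinRoot.of (m.map σ)) := by
  haveI := isLocalRing_adjoinRoot_section σ hσ m hm hirr
  refine ⟨fun a ha => ?_⟩
  by_contra hna
  have hmem : a ∈ maximalIdeal S := (IsLocalRing.mem_maximalIdeal a).mpr hna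
  have : AdjoinRoot.of (m.map σ) a ∈ maximalIdeal (AdjoinRoot (m.map σ)) := by
    rw [maximalIdeal_adjoinRoot_section σ hσ m hm hirr]
    exact Ideal.mem_map_of_mem _ hmem
  exact ((IsLocalRing.mem_maximalIdeal _).mp this) ha

/-! ## §3 Dimension, regularity, completeness -/

/-- `S′` is a finite `S`-module (monic modulus). -/
theorem moduleFinite_adjoinRoot (hm : m.Monic) : Module.Finite S (AdjoinRoot (m.map σ)) :=
  (monic_map_section σ m hm).finite_adjoinRoot

/-- For a MONIC modulus of positive degree over any commutative ring, `S → S[T]/(g)` is injective. -/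
theorem of_injective_of_monic {g : S[X]} (hg : g.Monic) (hdeg : 0 < g.natDegree) : Function.Injective (AdjoinRoot.of g) := by
  intro a b hab
  rw [← sub_eq_zero] at hab ⊢
  rw [← map_sub] at hab
  have hdvd : g ∣ Polynomial.C (a - b) := by
    rw [← AdjoinRoot.mk_eq_zero]
    rw [← AdjoinRoot.mk_C] at hab
    exact hab
  have hmod : Polynomial.C (a - b) %ₘ g = Polynomial.C (a - b) := by
    rw [Polynomial.modByMonic_eq_self_iff hg]
    refine lt_of_le_of_lt Polynomial.degree_C_le ?_
    rw [Polynomial.degree_eq_natDegree hg.ne_zero]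
    exact_mod_cast hdeg
  have h0 : Polynomial.C (a - b) = 0 := by
    rw [← hmod]; exact (Polynomial.modByMonic_eq_zero_iff_dvd hg).mpr hdvd
  exact Polynomial.C_eq_zero.mp h0

/-- `dim S′ = dim S`. -/
theorem ringKrullDim_adjoinRoot_section (hm : m.Monic) (hdeg : 0 < m.natDegree) :
    ringKrullDim (AdjoinRoot (m.map σ)) = ringKrullDim S := by
  haveI := moduleFinite_adjoinRoot σ m hm
  haveI : Algebra.IsIntegral S (AdjoinRoot (m.map σ)) := Algebra.IsIntegral.of_finite S _
  refine (Literature.RingTheory.KrullDimension.ringKrullDim_eq_of_isIntegral (R := S) (S := AdjoinRoot (m.map σ)) ?_).symm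
  rw [AdjoinRoot.algebraMap_eq]
  exact of_injective_of_monic (monic_map_section σ m hm) (by rwa [hm.natDegree_map σ])

include hσ in
/-- **`S` regular local ⇒ `S′` regular local** (its maximal ideal `𝔪_S·S′` is generated by `emb dim S = dim S = dim S′` elements).
[cite: Matsumura1987, proof of Thm. 29.1, p. 223] -/
theorem isRegularLocalRing_adjoinRoot_section (hS : IsRegularLocalRing S) (hm : m.Monic) (hirr : Irreducible m) :
    haveI := isLocalRing_adjoinRoot_section σ hσ m hm hirr
    IsRegularLocalRing (AdjoinRoot (m.map σ)) := by
  classical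
  haveI := isLocalRing_adjoinRoot_section σ hσ m hm hirr
  haveI := moduleFinite_adjoinRoot σ m hm
  haveI : IsNoetherianRing (AdjoinRoot (m.map σ)) := inferInstance
  have hdeg : 0 < m.natDegree := hirr.natDegree_pos
  have hdim := ringKrullDim_adjoinRoot_section σ m hm hdeg
  -- `emb dim S′ ≤ emb dim S = dim S = dim S′`
  obtain ⟨s, hscard, hsspan⟩ :=
    Submodule.FG.exists_span_finset_card_eq_spanFinrank (IsNoetherian.noetherian (maximalIdeal S))
  have hmap : maximalIdeal (AdjoinRoot (m.map σ)) =
      Ideal.span ((s.image (AdjoinRoot.of (m.map σ)) : Finset (AdjoinRoot (m.map σ))) : Set _) := by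
    rw [maximalIdeal_adjoinRoot_section σ hσ m hm hirr, ← hsspan, Ideal.map_span, Finset.coe_image]
  have hle : (maximalIdeal (AdjoinRoot (m.map σ))).spanFinrank ≤ (maximalIdeal S).spanFinrank := by
    rw [hmap, ← hscard]
    refine (Submodule.spanFinrank_span_le_ncard_of_finite (Finset.finite_toSet _)).trans ?_
    rw [Set.ncard_coe_finset]
    exact Finset.card_image_le
  have hreg : ((maximalIdeal S).spanFinrank : WithBot ℕ∞) = ringKrullDim S := (isRegularLocalRing_iff S).mp hS
  refine IsRegularLocalRing.of_spanFinrank_maximalIdeal_le _ ?_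
  calc ((maximalIdeal (AdjoinRoot (m.map σ))).spanFinrank : WithBot ℕ∞)
      ≤ (maximalIdeal S).spanFinrank := by exact_mod_cast hle
    _ = ringKrullDim S := hreg
    _ = ringKrullDim (AdjoinRoot (m.map σ)) := hdim.symm

include hσ in
/-- **`S` Noetherian and `𝔪`-adically complete ⇒ `S′` is `𝔪_{S′}`-adically complete.** [folklore] -/
theorem isAdicComplete_adjoinRoot_section [IsNoetherianRing S] [IsAdicComplete (maximalIdeal S) S] (hm : m.Monic)
    (hirr : Irreducible m) :
    haveI := isLocalRing_adjoinRoot_section σ hσ m hm hirr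
    IsAdicComplete (maximalIdeal (AdjoinRoot (m.map σ))) (AdjoinRoot (m.map σ)) := by
  haveI := isLocalRing_adjoinRoot_section σ hσ m hm hirr
  haveI := moduleFinite_adjoinRoot σ m hm
  rw [maximalIdeal_adjoinRoot_section σ hσ m hm hirr, ← AdjoinRoot.algebraMap_eq]
  exact isAdicComplete_map_of_finite S (AdjoinRoot (m.map σ)) (maximalIdeal S)


/-! ## §4 The residue field of `S′` is `κ[T]/(m)`, perfect when `κ` is; the induced coefficient-field section -/

include hσ in
/-- The reduction of `m̃` modulo `𝔪_S`, as a polynomial over `κ = S ⧸ 𝔪_S`, is `m`. -/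
theorem map_mk_maximalIdeal_eq : (m.map σ).map (Ideal.Quotient.mk (maximalIdeal S)) = m :=
  map_map_residue_eq σ hσ m

include hσ in
/-- **The residue field of `S′ = S[T]/(m̃)` is `κ[T]/(m)`** (as rings): `S′ ⧸ 𝔪_S·S′ ≅ κ[T]/(m̄)` with `m̄ = m`. [folklore] -/
theorem nonempty_residueField_ringEquiv_adjoinRoot (hm : m.Monic) (hirr : Irreducible m) :
    haveI := isLocalRing_adjoinRoot_section σ hσ m hm hirr
    Nonempty (ResidueField (AdjoinRoot (m.map σ)) ≃+* AdjoinRoot m) := by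
  haveI := isLocalRing_adjoinRoot_section σ hσ m hm hirr
  -- `S′ ⧸ 𝔪′ = S′ ⧸ 𝔪S′ ≅ κ[T] ⧸ (m̃.map mk) = κ[T] ⧸ (m)`
  have h1 : ResidueField (AdjoinRoot (m.map σ)) ≃+*
      AdjoinRoot (m.map σ) ⧸ (maximalIdeal S).map (AdjoinRoot.of (m.map σ)) :=
    Ideal.quotEquivOfEq (maximalIdeal_adjoinRoot_section σ hσ m hm hirr)
  have h2 := (AdjoinRoot.quotEquivQuotMap (m.map σ) (maximalIdeal S)).toRingEquiv
  have h3 : Polynomial (ResidueField S) ⧸ Ideal.span {(m.map σ).map (Ideal.Quotient.mk (maximalIdeal S))} ≃+*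
      AdjoinRoot m :=
    Ideal.quotEquivOfEq (by rw [map_mk_maximalIdeal_eq σ hσ m]; rfl)
  exact ⟨h1.trans (h2.trans h3)⟩

include hσ in
/-- **The residue field of `S′` is PERFECT when `κ` is** (it is the algebraic extension `κ[T]/(m)` of `κ`). [folklore] -/
theorem perfectField_residueField_adjoinRoot [PerfectField (ResidueField S)] (hm : m.Monic) (hirr : Irreducible m) :
    haveI := isLocalRing_adjoinRoot_section σ hσ m hm hirr
    PerfectField (ResidueField (AdjoinRoot (m.map σ))) := by
  haveI := isLocalRing_adjoinRoot_section σ hσ m hm hirr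
  haveI : Fact (Irreducible m) := ⟨hirr⟩
  haveI : Module.Finite (ResidueField S) (AdjoinRoot m) := hm.finite_adjoinRoot
  haveI : Algebra.IsAlgebraic (ResidueField S) (AdjoinRoot m) := Algebra.IsAlgebraic.of_finite _ _
  haveI : PerfectField (AdjoinRoot m) := Algebra.IsAlgebraic.perfectField (ResidueField S)
  obtain ⟨e⟩ := nonempty_residueField_ringEquiv_adjoinRoot σ hσ m hm hirr
  exact PerfectField.of_ringEquiv e.symm

/-- The root of `m̃` in `S′` is a root of `m` read through `ι ∘ σ`. -/
theorem eval₂_of_comp_section_root : m.eval₂ ((AdjoinRoot.of (m.map σ)).comp σ) (AdjoinRoot.root (m.map σ)) = 0 := by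
  rw [← Polynomial.eval₂_map]
  exact AdjoinRoot.eval₂_root (m.map σ)

include hσ in
/-- `m̃` read through `residue` has the root `root m` in `κ[T]/(m)`. -/
theorem eval₂_of_comp_residue_root :
    (m.map σ).eval₂ ((AdjoinRoot.of m).comp (residue S)) (AdjoinRoot.root m) = 0 := by
  rw [← Polynomial.eval₂_map, map_map_residue_eq σ hσ m]
  exact AdjoinRoot.eval₂_root m

/-- Changing the coefficients of `g` by elements of `𝔪_S` moves `mk g` inside `𝔪_S · S′`. -/
theorem mk_map_sub_mk_mem (f : S[X]) (h : S →+* S) (hh : ∀ c, h c - c ∈ maximalIdeal S) (g : S[X]) :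
    AdjoinRoot.mk f (g.map h) - AdjoinRoot.mk f g ∈ (maximalIdeal S).map (AdjoinRoot.of f) := by
  induction g using Polynomial.induction_on with
  | C a =>
    rw [Polynomial.map_C, AdjoinRoot.mk_C, AdjoinRoot.mk_C, ← map_sub]
    exact Ideal.mem_map_of_mem _ (hh a)
  | add p q hp hq =>
    rw [Polynomial.map_add, map_add, map_add, add_sub_add_comm]
    exact Ideal.add_mem _ hp hq
  | monomial n a _ =>
    simp only [Polynomial.map_mul, Polynomial.map_pow, Polynomial.map_X, Polynomial.map_C, map_mul, map_pow]
    rw [← sub_mul, AdjoinRoot.mk_C, AdjoinRoot.mk_C, ← map_sub]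
    exact Ideal.mul_mem_right _ _ (Ideal.mem_map_of_mem _ (hh a))

/-- `AdjoinRoot.lift i x h (mk f g) = mk f' (g.map i)`-type evaluation: the lift sends `mk g` to the class of `g.map i` when the target
is itself `AdjoinRoot f'` with `x = root f'`. -/
theorem lift_mk_eq_mk_map {R T : Type u} [CommRing R] [CommRing T] (f : R[X]) (f' : T[X]) (i : R →+* T)
    (h : f.eval₂ ((AdjoinRoot.of f').comp i) (AdjoinRoot.root f') = 0) (g : R[X]) :
    AdjoinRoot.lift ((AdjoinRoot.of f').comp i) (AdjoinRoot.root f') h (AdjoinRoot.mk f g) = AdjoinRoot.mk f' (g.map i) := by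
  rw [AdjoinRoot.lift_mk, ← Polynomial.eval₂_map, ← AdjoinRoot.algebraMap_eq, ← Polynomial.aeval_def, AdjoinRoot.aeval_eq]

include hσ in
/-- **A coefficient-field SECTION of `S′` compatible with `σ`**: there is `σ′ : κ′ →+* S′` (`κ′` the residue field of `S′`) with
`residue ∘ σ′ = id`, `σ′ (residue (ι (σ a))) = ι (σ a)` and `σ′ (residue θ) = θ` — the map `κ[T]/(m) → S′`, `T ↦ θ`, coefficients through
`ι ∘ σ`, precomposed with `κ′ → κ[T]/(m)`. [cite: Matsumura1987, Thm. 28.3 (ii)] -/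
theorem exists_section_adjoinRoot (hm : m.Monic) (hirr : Irreducible m) :
    haveI := isLocalRing_adjoinRoot_section σ hσ m hm hirr
    ∃ σ' : ResidueField (AdjoinRoot (m.map σ)) →+* AdjoinRoot (m.map σ),
      (∀ b, residue (AdjoinRoot (m.map σ)) (σ' b) = b) ∧
      (∀ a : ResidueField S, σ' (residue (AdjoinRoot (m.map σ)) (AdjoinRoot.of (m.map σ) (σ a))) =
        AdjoinRoot.of (m.map σ) (σ a)) ∧
      σ' (residue (AdjoinRoot (m.map σ)) (AdjoinRoot.root (m.map σ))) = AdjoinRoot.root (m.map σ) := by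
  haveI := isLocalRing_adjoinRoot_section σ hσ m hm hirr
  have hmax := maximalIdeal_adjoinRoot_section σ hσ m hm hirr
  -- `τ : κ[T]/(m) → S′`, `T ↦ θ`, coefficients through `ι ∘ σ`
  let τ : AdjoinRoot m →+* AdjoinRoot (m.map σ) :=
    AdjoinRoot.lift ((AdjoinRoot.of (m.map σ)).comp σ) (AdjoinRoot.root (m.map σ)) (eval₂_of_comp_section_root σ m)
  -- `ψ : S′ → κ[T]/(m)`, `θ ↦ T`, coefficients through `residue`; it kills `𝔪_S · S′ = 𝔪′`
  let ψ : AdjoinRoot (m.map σ) →+* AdjoinRoot m :=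
    AdjoinRoot.lift ((AdjoinRoot.of m).comp (residue S)) (AdjoinRoot.root m) (eval₂_of_comp_residue_root σ hσ m)
  have hψ : ∀ a ∈ maximalIdeal (AdjoinRoot (m.map σ)), ψ a = 0 := by
    intro a ha
    rw [hmax] at ha
    have hle : (maximalIdeal S).map (AdjoinRoot.of (m.map σ)) ≤ RingHom.ker ψ := by
      rw [Ideal.map_le_iff_le_comap]
      intro c hc
      rw [Ideal.mem_comap, RingHom.mem_ker]
      change AdjoinRoot.lift _ _ _ (AdjoinRoot.of (m.map σ) c) = 0
      rw [AdjoinRoot.lift_of, RingHom.comp_apply, (IsLocalRing.residue_eq_zero_iff c).mpr hc, map_zero]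
    exact hle ha
  let ψbar : ResidueField (AdjoinRoot (m.map σ)) →+* AdjoinRoot m :=
    Ideal.Quotient.lift (maximalIdeal (AdjoinRoot (m.map σ))) ψ hψ
  have hψbar : ∀ a, ψbar (residue _ a) = ψ a := fun a => Ideal.Quotient.lift_mk _ _ _
  have hτψ_of : ∀ g : S[X], τ (ψ (AdjoinRoot.mk (m.map σ) g)) = AdjoinRoot.mk (m.map σ) (g.map (σ.comp (residue S))) := by
    intro g
    change τ (AdjoinRoot.lift _ _ _ (AdjoinRoot.mk (m.map σ) g)) = _
    rw [lift_mk_eq_mk_map]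
    change AdjoinRoot.lift _ _ _ (AdjoinRoot.mk m (g.map (residue S))) = _
    rw [lift_mk_eq_mk_map, Polynomial.map_map]
  refine ⟨τ.comp ψbar, fun b => ?_, fun a => ?_, ?_⟩
  · obtain ⟨a, rfl⟩ := Ideal.Quotient.mk_surjective b
    obtain ⟨g, rfl⟩ := AdjoinRoot.mk_surjective a
    change residue _ (τ (ψbar (residue _ (AdjoinRoot.mk (m.map σ) g)))) = residue _ (AdjoinRoot.mk (m.map σ) g)
    rw [hψbar, hτψ_of, ← sub_eq_zero, ← map_sub, IsLocalRing.residue_eq_zero_iff, hmax]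
    exact mk_map_sub_mk_mem (m.map σ) (σ.comp (residue S)) (fun c => by
      rw [← IsLocalRing.residue_eq_zero_iff, map_sub, RingHom.comp_apply, hσ, sub_self]) g
  · change τ (ψbar (residue _ (AdjoinRoot.of (m.map σ) (σ a)))) = _
    rw [hψbar]
    change AdjoinRoot.lift _ _ _ (AdjoinRoot.lift _ _ _ (AdjoinRoot.of (m.map σ) (σ a))) = _
    rw [AdjoinRoot.lift_of, RingHom.comp_apply, hσ, AdjoinRoot.lift_of, RingHom.comp_apply]
  · change τ (ψbar (residue _ (AdjoinRoot.root (m.map σ)))) = _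
    rw [hψbar]
    change AdjoinRoot.lift _ _ _ (AdjoinRoot.lift _ _ _ (AdjoinRoot.root (m.map σ))) = _
    rw [AdjoinRoot.lift_root, AdjoinRoot.lift_root]

end Summit.ResolutionOfSingularities.ResolutionOfSingularities.Theorems.SwitchingDichotomy.HatBaseChange

end
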